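import Summits.QuantumFields.BalabanUV.T4Continuum.Support.NE3QbarIterNearFlat
import Summits.QuantumFields.BalabanUV.T4Continuum.Support.NE3TopRadiusLetters
import Summits.QuantumFields.BalabanUV.T4Continuum.Support.AveragingDeficitLiftDefectSum
import HarnessLib

/-!
# T⁴ programme, node NE3 — route Π, row Π-R (curved step), file Π-R-W4c¹ (prep of the crux estimate): THE REGIONAL GEOMETRY OF ONE
# COARSE BOND, THE CLASS AT EVERY LEVEL, THE CLOSED-FORM NEAR-IDENTITY TOWER, AND THE k-FREE LEVEL SUMS

NE3 (node U1b) formalisation swarm, leaf seat `b2b-balaban-t4-ne3-formalise-leaf-01` (gen 8); re-planned row Π-R-W (FINDING F-ne3leaf01g8-1,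
`HOME/CLAIMS.log` 2026-08-20 ≈23:04Z).  The crux estimate W4c reads ONE coarse bond `(z,κ)` of `QbarIter L (k+1) W (covLift M W φ)` in the comb
(axial) gauge based at the SHIFTED corner `M•(z − t𝟙)`, `t = baseShift d L = nbRad + d + 1`, which covers the whole reading region (the ℓ¹-balls
`B_m` of W4b and the lift's transport paths) by its forward cone, where `NE3CombGauge.norm_comb_sub_one_le` makes every bond `O(M·x)`-close to `1`.
THIS FILE supplies the manuscript-free bookkeeping: §1 the constants (`liftC = 24·8^{d−1}`, `baseShift`, `regC`, `rhoC`, `cruxC` — explicit polynomials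
in `d, L`, DATA defs); §2 ℓ¹-geometry (`sum_pow_le_pow`, the shifted-base lemma `shift_le_and_l1_le`, the block locality
`l1_blk_sub_le`); §3 the class at every level of the tower (`class_at_level`: unitary, radius `x_i = (prop1Radius)^[i] x ≥ 0`, small field, the
`512`-smallness); §4 the CLOSED-FORM near-identity tower **`norm_cavgIter_sub_one_le_closed`**: level-0 `‖W − 1‖ ≤ δ` on `B_{k+1}` ⇒
`‖cavgIter L i W − 1‖ ≤ L^i·δ + 2·loopRad d L (x_i)` on `B_{k+1−i}` (`L ≥ 2`: `(L+2)·loopRad(x_i) ≤ loopRad(x_{i+1})` absorbs the one-step `4·loopRad`);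
§5 the k-FREE level sums `sum_loopRad_iterate_le` (`Σ_{i<K} loopRad(x_i) ≤ (4∕3)·loopRad(x_{K−1})`) and `sum_rho_le` (the sum of W4b's
`norm_QbarIter_sub_linQIter_le` with `δ_i = L^iδ₀ + 2·loopRad(x_i)`, `δ₀ = regC·M·x`, is `≤ rhoC·M²·x` by `NE3TopRadiusLetters.loopRad_iterate_le_of_levelSmall`).

HONEST FRAMING.  Kinematics∕arithmetic of OUR objects; nothing about minimisers; (P♮)_W, T-E_w and **NE3 are NOT proved**; spine PROVED 0∕9; finite T⁴ rung
(B)+1 — NOT infinite volume, NOT mass gap, NOT `BetaPertH`, NOT Clay.  PLACEMENT: `Summits/QuantumFields/BalabanUV/`.  HONEST DEPENDENCY (cell page 1):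
continuum YM on T⁴ ⇐ BetaPertH ∧ nine spine estimates (0/9 proved); BetaPertH ⇐ (D1) ∧ (D4) ∧ CAP+tail; G-an2-4 gates asym, D1 and NE2/3/4.
-/

set_option autoImplicit false

open scoped BigOperators Matrix.Norms.L2Operator
open Finset

namespace Summit.QuantumFields.BalabanUV.T4Continuum.NE3QbarIterCovLiftPrep

open Literature.MathematicalPhysics.QuantumFieldTheory.Balaban1983to89
open B7Prop1Explicit B7Prop2Explicit
open T4AveragingDeficitWall (IsUnitaryCfg SmallField Ad)
open AveragingDeficitChartCalculus (cavg)
open AveragingDeficitMultiLevelPrep (cavgIter LevelSmall prop1Radius_nonneg cavgIter_unitary_small)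
open AveragingDeficitTwoLevelPrep (prop1Radius twoLevelSmall)
open SpreadLift (loopRad)
open BlockAverageVaryHolo (nbRad l1_sub_self)
open SmoothRefineBlocks (blk res blk_add_res res_nonneg res_le)
open NE3TangentCovariantTower (cavgIter_succ' step_small)
open NE3CovariantLineSumsError (Csup Csup_nonneg sq_mul_le_prop1Radius iterate_prop1Radius_nonneg)
open NE3TopRadiusLetters (loopRad_iterate_le_of_levelSmall radIter_eq_iterate)
open NE3QbarIterNearFlat (l1_smul_sub rad_succ pow_succ_smul norm_cavg_sub_one_le_ball)
open AveragingDeficitLiftDefectSum (natAbs_le_l1)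

noncomputable section

variable {d : ℕ} {n : Type*} [Fintype n] [DecidableEq n]

/-! ## §1 The constants -/

/-- The sup constant of the smooth lift: `‖smoothLift M φ‖ ≤ (liftC d ∕ M)·‖φ‖` (`NE3SmoothLiftBounds.norm_smoothLift_le`). [folklore] -/
def liftC (d : ℕ) : ℝ := 24 * (8 : ℝ) ^ (d - 1)

/-- The base shift (in blocks) of the regional comb gauge: `t = nbRad + d + 1`. [folklore] -/
def baseShift (d L : ℕ) : ℕ := nbRad d L + d + 1

/-- The ℓ¹-reach (in units of `M`) of the reading region from the shifted base: `regC = nbRad + 2d + 1 + d·baseShift` (every bond used is within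
`regC·M` of `M•(z − t𝟙)`, so `(regC·M)·x`-close to `1` in the regional comb gauge). [folklore] -/
def regC (d L : ℕ) : ℝ := (nbRad d L : ℝ) + 2 * d + 1 + d * (baseShift d L : ℝ)

/-- The k-free level-sum constant: `Σ_{i≤k} ρ_i ≤ rhoC·M²·x` (see `sum_rho_le`). [folklore] -/
def rhoC (d L : ℕ) : ℝ :=
  (2 * (d : ℝ) + 4) * (L : ℝ) ^ 2 * regC d L
    + 4 / 3 * (2 * ((2 * (d : ℝ) + 4) * (L : ℝ) ^ 2) + (8 * (L : ℝ) + Csup d L)) * (17 * (((d : ℝ) + 1) * ((d : ℝ) + 4)))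

/-- **THE CRUX CONSTANT**: `‖QbarIter L (k+1) W (covLift M W φ) z κ − φ z κ‖ ≤ cruxC·M²·x·sup_loc‖φ‖` (W4c). [folklore] -/
def cruxC (d L : ℕ) : ℝ := 2 * liftC d * (2 * ((d : ℝ) + 1) * regC d L + rhoC d L / L)

/-- `0 ≤ liftC`. [folklore] -/
theorem liftC_nonneg (d : ℕ) : 0 ≤ liftC d := by unfold liftC; positivity

/-- `0 ≤ regC`. [folklore] -/
theorem regC_nonneg (d L : ℕ) : 0 ≤ regC d L := by unfold regC; positivity

/-- `0 ≤ rhoC`. [folklore] -/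
theorem rhoC_nonneg (d L : ℕ) : 0 ≤ rhoC d L := by unfold rhoC; have := Csup_nonneg d L; have := regC_nonneg d L; positivity

/-! ## §2 ℓ¹-geometry of the reading region -/

/-- `Σ_{i<K} L^i ≤ L^K` for `L ≥ 2` (in ℕ). [folklore] -/
theorem sum_pow_le_pow {L : ℕ} (hL : 2 ≤ L) : ∀ K : ℕ, (∑ i ∈ Finset.range K, L ^ i) ≤ L ^ K
  | 0 => by simp
  | K + 1 => by
      rw [Finset.sum_range_succ, pow_succ]
      have ih := sum_pow_le_pow hL K
      have : L ^ K * 2 ≤ L ^ K * L := Nat.mul_le_mul_left _ hL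
      omega

/-- The real form: `Σ_{i<K} (L:ℝ)^i ≤ (L:ℝ)^K` for `L ≥ 2`. [folklore] -/
theorem sum_pow_le_pow_real {L : ℕ} (hL : 2 ≤ L) (K : ℕ) : (∑ i ∈ Finset.range K, (L : ℝ) ^ i) ≤ (L : ℝ) ^ K := by
  have h := sum_pow_le_pow hL K
  exact_mod_cast h

/-- **THE SHIFTED BASE COVERS THE BALL**: if `|y − M•z|₁ ≤ R` and `R ≤ M·t`, then `M•(z − t𝟙) ≤ y` componentwise and `|y − M•(z − t𝟙)|₁ ≤ R + d·(M·t)`.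
[folklore] -/
theorem shift_le_and_l1_le {M t R : ℕ} {y z : Site d} (hy : l1 (y - (M : ℤ) • z) ≤ R) (hR : R ≤ M * t) :
    (M : ℤ) • (fun i => z i - (t : ℤ)) ≤ y ∧ l1 (y - (M : ℤ) • (fun i => z i - (t : ℤ))) ≤ R + d * (M * t) := by
  have hcoord : ∀ i, ((y - (M : ℤ) • z) i).natAbs ≤ R := fun i => (natAbs_le_l1 _ i).trans hy
  constructor
  · intro i
    have h := hcoord i
    simp only [Pi.sub_apply, Pi.smul_apply, smul_eq_mul] at h
    simp only [Pi.smul_apply, smul_eq_mul]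
    have : (R : ℤ) ≤ (M : ℤ) * t := by exact_mod_cast hR
    have h' : |y i - (M : ℤ) * z i| ≤ (R : ℤ) := by rw [Int.abs_eq_natAbs]; exact_mod_cast h
    obtain ⟨h1, -⟩ := abs_le.mp h'
    rw [mul_sub]
    omega
  · unfold l1
    calc ∑ κ : Fin d, ((y - (M : ℤ) • fun i => z i - (t : ℤ)) κ).natAbs
        ≤ ∑ κ : Fin d, (((y - (M : ℤ) • z) κ).natAbs + M * t) := by
          refine Finset.sum_le_sum fun κ _ => ?_
          simp only [Pi.sub_apply, Pi.smul_apply, smul_eq_mul, mul_sub]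
          have : y κ - ((M : ℤ) * z κ - (M : ℤ) * (t : ℤ)) = (y κ - (M : ℤ) * z κ) + (M : ℤ) * t := by ring
          rw [this]
          have h := Int.natAbs_add_le (y κ - (M : ℤ) * z κ) ((M : ℤ) * t)
          have h2 : (((M : ℤ) * (t : ℤ)).natAbs) = M * t := by rw [Int.natAbs_mul]; simp
          omega
      _ = (∑ κ : Fin d, ((y - (M : ℤ) • z) κ).natAbs) + d * (M * t) := by
          rw [Finset.sum_add_distrib, Finset.sum_const, Finset.card_univ, Fintype.card_fin, smul_eq_mul]
      _ ≤ R + d * (M * t) := by unfold l1 at hy; omega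

/-- **BLOCK LOCALITY**: `|y − M•z|₁ ≤ M·R` ⇒ `|blk M y − z|₁ ≤ R + d` (`M ≥ 1`; the offsets `res` are in `[0, M)`). [folklore] -/
theorem l1_blk_sub_le {M R : ℕ} (hM : 1 ≤ M) {y z : Site d} (hy : l1 (y - (M : ℤ) • z) ≤ M * R) : l1 (blk M y - z) ≤ R + d := by
  -- `M·|blk y − z|₁ = |M•blk y − M•z|₁ ≤ |y − M•z|₁ + |res y|₁ ≤ M·R + d·(M−1) < M·(R + d + 1)`
  have hres : l1 (res M y) ≤ d * (M - 1) := by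
    unfold l1
    calc ∑ κ : Fin d, (res M y κ).natAbs ≤ ∑ _κ : Fin d, (M - 1) := Finset.sum_le_sum fun κ _ => by
            have h0 := res_nonneg hM y κ
            have h1 := res_le hM y κ
            have : ((res M y κ).natAbs : ℤ) ≤ (M : ℤ) - 1 := by rw [Int.natAbs_of_nonneg h0]; exact h1
            omega
      _ = d * (M - 1) := by rw [Finset.sum_const, Finset.card_univ, Fintype.card_fin, smul_eq_mul]
  have hsplit : (M : ℤ) • blk M y - (M : ℤ) • z = (y - (M : ℤ) • z) - res M y := by
    rw [eq_sub_of_add_eq (blk_add_res M y)]; abel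
  have hM' : M * l1 (blk M y - z) ≤ M * R + d * (M - 1) := by
    rw [← l1_smul_sub, hsplit, sub_eq_add_neg]
    have h := l1_add_le (y - (M : ℤ) • z) (-res M y)
    rw [B7Prop1Explicit.l1_neg] at h
    omega
  have hlt : M * l1 (blk M y - z) < M * (R + d + 1) := by
    have : d * (M - 1) < M * (d + 1) := by
      have := Nat.sub_le M 1
      nlinarith
    nlinarith
  have := Nat.lt_of_mul_lt_mul_left hlt
  omega

/-! ## §3 The class at every level of the tower -/

omit [Fintype n] [DecidableEq n] in
/-- `LevelSmall` descends: `LevelSmall (i + m) x → LevelSmall i x`. [folklore] -/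
theorem levelSmall_of_add {L : ℕ} : ∀ (m i : ℕ) {x : ℝ}, LevelSmall d L (i + m) x → LevelSmall d L i x
  | 0, _, _, h => h
  | m + 1, i, x, h => by
      have h' : LevelSmall d L (i + m) x := by
        have key : ∀ (j : ℕ) {y : ℝ}, LevelSmall d L (j + 1) y → LevelSmall d L j y := by
          intro j
          induction j with
          | zero => intro y hy; exact hy.1
          | succ j ih => intro y hy; exact ⟨hy.1, ih hy.2⟩
        exact key (i + m) (by rw [show i + m + 1 = i + (m + 1) by ring]; exact h)
      exact levelSmall_of_add m i h'

/-- **THE CLASS AT LEVEL `i ≤ k`**: unitarity, the radius `x_i = (prop1Radius)^[i] x ≥ 0`, the small field, and the `512`-smallness of B7 Prop. 1 at that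
radius. [cite: Balaban1985Averaging, Prop. 1 p.24] -/
theorem class_at_level [Nonempty n] {L : ℕ} (hL : 1 ≤ L) {k : ℕ} {W : Site d → Fin d → (Matrix n n ℂ)ˣ} {x : ℝ} (hWu : IsUnitaryCfg W)
    (hx : 0 ≤ x) (hs : LevelSmall d L k x) (hWx : SmallField W x) (i : ℕ) (hi : i ≤ k) :
    IsUnitaryCfg (cavgIter L i W) ∧ 0 ≤ (prop1Radius d L)^[i] x ∧ SmallField (cavgIter L i W) ((prop1Radius d L)^[i] x)
      ∧ 512 * (d + 1) * (d + 4) * (L : ℝ) ^ 2 * (prop1Radius d L)^[i] x ≤ 1 := by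
  obtain ⟨m, rfl⟩ := Nat.exists_eq_add_of_le hi
  have hsi : LevelSmall d L i x := levelSmall_of_add m i hs
  have htop := NE3CovariantLineSumsError.LevelSmall.top (d := d) hsi
  rcases i with _ | i
  · simp only [Function.iterate_zero, id_eq] at htop ⊢
    obtain ⟨h512, -, -, -⟩ := step_small hL hWu hx htop hWx
    exact ⟨hWu, hx, hWx, h512⟩
  · have hsi' : LevelSmall d L i x := levelSmall_of_add 1 i hsi
    obtain ⟨hu, hr, hsf⟩ := cavgIter_unitary_small hL i hWu hx hsi' hWx
    rw [radIter_eq_iterate] at hr hsf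
    obtain ⟨h512, -, -, -⟩ := step_small hL hu hr htop hsf
    exact ⟨hu, hr, hsf, h512⟩

/-! ## §4 The closed-form near-identity tower -/

/-- `(L + 2)·loopRad(x_i) ≤ loopRad(x_{i+1})` (`L ≥ 2`, `x_i ≥ 0`): `prop1Radius y ≥ L²y` and `L + 2 ≤ L²`. [folklore] -/
theorem loopRad_step_le {L : ℕ} (hL : 2 ≤ L) {y : ℝ} (hy : 0 ≤ y) : ((L : ℝ) + 2) * loopRad d L y ≤ loopRad d L (prop1Radius d L y) := by
  have hsq := sq_mul_le_prop1Radius (d := d) L y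
  have hL2 : (2 : ℝ) ≤ L := by exact_mod_cast hL
  have hLL : (L : ℝ) + 2 ≤ (L : ℝ) ^ 2 := by nlinarith
  unfold loopRad
  have hc : (0 : ℝ) ≤ 2 * (8 * ((d : ℝ) + 1) * ((d : ℝ) + 4) * (L : ℝ) ^ 2) := by positivity
  have h1 : ((L : ℝ) + 2) * y ≤ prop1Radius d L y := (mul_le_mul_of_nonneg_right hLL hy).trans hsq
  nlinarith [mul_le_mul_of_nonneg_left h1 hc]

/-- **THE CLOSED-FORM NEAR-IDENTITY TOWER** (`L ≥ 2`): in the class, if `‖W − 1‖ ≤ δ` on the fine ball `B_{k+1} = {|y − L^{k+1}•c|₁ ≤ nbRad·Σ_{i<k+1}L^i}`,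
then for `i + m = k + 1`, `‖cavgIter L i W (y,μ) − 1‖ ≤ L^i·δ + 2·loopRad d L (x_i)` on `B_m` (outer induction on the level; W4b's one-step ball lemma).
[folklore] -/
theorem norm_cavgIter_sub_one_le_closed [Nonempty n] {L : ℕ} (hL : 2 ≤ L) {k : ℕ} {W : Site d → Fin d → (Matrix n n ℂ)ˣ} {x : ℝ}
    (hWu : IsUnitaryCfg W) (hx : 0 ≤ x) (hs : LevelSmall d L k x) (hWx : SmallField W x) (c : Site d) {δ : ℝ}
    (hW : ∀ (x' : Site d) (μ : Fin d), l1 (x' - ((L : ℤ) ^ (k + 1)) • c) ≤ nbRad d L * ∑ i ∈ Finset.range (k + 1), L ^ i →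
      ‖((W x' μ : (Matrix n n ℂ)ˣ) : Matrix n n ℂ) - 1‖ ≤ δ) :
    ∀ (i m : ℕ), i + m = k + 1 → ∀ (y : Site d) (μ : Fin d), l1 (y - ((L : ℤ) ^ m) • c) ≤ nbRad d L * ∑ i ∈ Finset.range m, L ^ i →
      ‖((cavgIter L i W y μ : (Matrix n n ℂ)ˣ) : Matrix n n ℂ) - 1‖ ≤ (L : ℝ) ^ i * δ + 2 * loopRad d L ((prop1Radius d L)^[i] x) := by
  intro i
  induction i with
  | zero =>
      intro m him y μ hy
      have hm : m = k + 1 := by omega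
      subst hm
      have h := hW y μ hy
      have hl : 0 ≤ loopRad d L x := by unfold loopRad; positivity
      simp only [pow_zero, one_mul, Function.iterate_zero, id_eq]
      show ‖((W y μ : (Matrix n n ℂ)ˣ) : Matrix n n ℂ) - 1‖ ≤ _
      linarith
  | succ i ih =>
      intro m him y μ hy
      obtain ⟨hu, hr, hsf, h512⟩ := class_at_level (by omega) hWu hx hs hWx i (by omega)
      -- the level-`i` bound on the ball one level down
      have hball : ∀ (x' : Site d) (ν : Fin d), l1 (x' - (L : ℤ) • (((L : ℤ) ^ m) • c)) ≤ nbRad d L + L * (nbRad d L * ∑ i ∈ Finset.range m, L ^ i) →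
          ‖((cavgIter L i W x' ν : (Matrix n n ℂ)ˣ) : Matrix n n ℂ) - 1‖ ≤ (L : ℝ) ^ i * δ + 2 * loopRad d L ((prop1Radius d L)^[i] x) :=
        fun x' ν hx' => ih (m + 1) (by omega) x' ν (by rw [pow_succ_smul, rad_succ]; exact hx')
      have h := norm_cavg_sub_one_le_ball (by omega) hu hr h512 hsf hball y μ hy
      rw [cavgIter_succ']
      refine h.trans ?_
      have hstep := loopRad_step_le (d := d) hL hr
      rw [← Function.iterate_succ_apply' (prop1Radius d L) i x] at hstep
      have hl0 : 0 ≤ loopRad d L ((prop1Radius d L)^[i] x) := by unfold loopRad; positivity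
      rw [pow_succ]
      nlinarith

/-! ## §5 The k-free level sums -/

/-- `Σ_{i<K} loopRad(x_i) ≤ (4∕3)·loopRad(x_{K−1})` for `K ≥ 1`, `L ≥ 2` (each lower level is at most a quarter of the next). [folklore] -/
theorem sum_loopRad_iterate_le {L : ℕ} (hL : 2 ≤ L) {x : ℝ} (hx : 0 ≤ x) :
    ∀ K : ℕ, (∑ i ∈ Finset.range (K + 1), loopRad d L ((prop1Radius d L)^[i] x)) ≤ 4 / 3 * loopRad d L ((prop1Radius d L)^[K] x)
  | 0 => by
      simp only [zero_add, Finset.range_one, Finset.sum_singleton, Function.iterate_zero, id_eq]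
      have : 0 ≤ loopRad d L x := by unfold loopRad; positivity
      linarith
  | K + 1 => by
      rw [Finset.sum_range_succ]
      have ih := sum_loopRad_iterate_le hL hx K
      have hr : 0 ≤ (prop1Radius d L)^[K] x := iterate_prop1Radius_nonneg (d := d) K hx
      have hstep := loopRad_step_le (d := d) hL hr
      rw [← Function.iterate_succ_apply' (prop1Radius d L) K x] at hstep
      have hL2 : (2 : ℝ) ≤ L := by exact_mod_cast hL
      have hl0 : 0 ≤ loopRad d L ((prop1Radius d L)^[K] x) := by unfold loopRad; positivity
      nlinarith

/-- **THE LEVEL SUM OF THE CRUX** (`L ≥ 2`, class `LevelSmall d L k x`): with `δ_i = L^i·δ₀ + 2·loopRad(x_i)` and `δ₀ = regC·L^{k+1}·x`,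
`Σ_{i<k+1} ((2d+4)L²·δ_i + (8L + C_sup)·loopRad(x_i)) ≤ rhoC d L · (L^{k+1})² · x`. [folklore] -/
theorem sum_rho_le {L : ℕ} (hL : 2 ≤ L) (k : ℕ) {x : ℝ} (hx : 0 ≤ x) (hs : LevelSmall d L k x) :
    (∑ i ∈ Finset.range (k + 1), ((2 * (d : ℝ) + 4) * (L : ℝ) ^ 2 * ((L : ℝ) ^ i * (regC d L * (L : ℝ) ^ (k + 1) * x)
        + 2 * loopRad d L ((prop1Radius d L)^[i] x)) + (8 * (L : ℝ) + Csup d L) * loopRad d L ((prop1Radius d L)^[i] x)))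
      ≤ rhoC d L * (((L : ℝ) ^ (k + 1)) ^ 2 * x) := by
  set M : ℝ := (L : ℝ) ^ (k + 1) with hM
  set A : ℝ := (2 * (d : ℝ) + 4) * (L : ℝ) ^ 2 with hA
  set B : ℝ := 8 * (L : ℝ) + Csup d L with hB
  have hA0 : 0 ≤ A := by rw [hA]; positivity
  have hB0 : 0 ≤ B := by rw [hB]; have := Csup_nonneg d L; positivity
  have hM0 : 0 ≤ M := by rw [hM]; positivity
  have hreg := regC_nonneg d L
  -- split the sum
  have hsplit : (∑ i ∈ Finset.range (k + 1), (A * ((L : ℝ) ^ i * (regC d L * M * x) + 2 * loopRad d L ((prop1Radius d L)^[i] x))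
        + B * loopRad d L ((prop1Radius d L)^[i] x)))
      = A * (regC d L * M * x) * (∑ i ∈ Finset.range (k + 1), (L : ℝ) ^ i)
        + (2 * A + B) * (∑ i ∈ Finset.range (k + 1), loopRad d L ((prop1Radius d L)^[i] x)) := by
    rw [Finset.mul_sum, Finset.mul_sum, ← Finset.sum_add_distrib]
    exact Finset.sum_congr rfl fun i _ => by ring
  rw [hsplit]
  have hgeo := sum_pow_le_pow_real hL (k + 1)
  have hlr := sum_loopRad_iterate_le (d := d) hL hx k
  have htop := loopRad_iterate_le_of_levelSmall (d := d) hL k hx hs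
  rw [← hM] at hgeo htop
  have h1 : A * (regC d L * M * x) * (∑ i ∈ Finset.range (k + 1), (L : ℝ) ^ i) ≤ A * (regC d L * M * x) * M :=
    mul_le_mul_of_nonneg_left hgeo (by positivity)
  have h2 : (2 * A + B) * (∑ i ∈ Finset.range (k + 1), loopRad d L ((prop1Radius d L)^[i] x))
      ≤ (2 * A + B) * (4 / 3 * (17 * (((d : ℝ) + 1) * ((d : ℝ) + 4)) * (M ^ 2 * x))) := by
    refine mul_le_mul_of_nonneg_left (hlr.trans ?_) (by positivity)
    exact mul_le_mul_of_nonneg_left htop (by norm_num)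
  calc _ ≤ A * (regC d L * M * x) * M + (2 * A + B) * (4 / 3 * (17 * (((d : ℝ) + 1) * ((d : ℝ) + 4)) * (M ^ 2 * x))) := add_le_add h1 h2
    _ = rhoC d L * (M ^ 2 * x) := by rw [rhoC, hA, hB]; ring

end

end Summit.QuantumFields.BalabanUV.T4Continuum.NE3QbarIterCovLiftPrep
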